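import Mathlib
import Summits.PneNP.PneNP.Theorems.Nc03AvoidResidualCoreReductionSolveC
import Summits.PneNP.PneNP.Theorems.Nc03AvoidResidualCoreReductionLinC

/-!
# Route Nc03AvoidResidualCore, item `ResidualCoreReduction` — the solver, IX-b: class `10`

Helper file for `stmt-PneNP-20227` (sequel of `…ReductionSolveC`; cell pnp-ideate). Polynomial time
solver for the pure class `10` (`(¬b ∧ ¬c) ∨ (a ∧ b ∧ c)`): the program versions of `procSet` /
`gset` (the greedy independent family of tail-rows seeded at `i`, skipping `j`, via span tests), the
search for `(i, j, g)` as in `cert10_exists`, the indicator of the greedy family as output;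
correctness via `cert10_exists` / `cert10_sound` (`…ReductionLinC`); `CodeFP` proofs.
-/

set_option linter.dupNamespace false -- `Summit.PneNP.PneNP.…`: summit = sub-problem name (D-0017 single-conjunct layout)

namespace Summit.PneNP.PneNP.Theorems.Nc03Reduction

open Literature.Computability.Complexity CodeFP

variable {N M : ℕ}

/-- The tail-rows processed before `f` (seed `i` first, then by index, skipping `j` and `f`). -/
def procRows (pr : PRaw) (i j f : ℕ) : List (List ℕ) :=
  ((enumT pr).filter fun f' => !decide (f'.1 = j) && !decide (f'.1 = f) &&
    (decide (f'.1 = i) || (!decide (f = i) && decide (f'.1 < f)))).map fun f' => r9 f'.2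

/-- Membership of an output in the greedy family. -/
def inG (pr : PRaw) (i j : ℕ) (x : ETrip) : Bool :=
  !decide (x.1 = j) && !inSpan pr.1 (procRows pr i j x.1) (r9 x.2)

/-- The greedy family, as a list of output indices. -/
def gList (pr : PRaw) (i j : ℕ) : List ℕ := ((enumT pr).filter fun x => inG pr i j x).map fun x => x.1

/-- The tail-rows of the outputs other than `j`. -/
def rowsNe (pr : PRaw) (j : ℕ) : List (List ℕ) :=
  ((enumT pr).filter fun f => !decide (f.1 = j)).map fun f => r9 f.2

/-- Test, class `10`, on `(i, j, g)` (see `cert10_sound`). -/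
def test10 (q : PRaw × ETrip × ETrip × ETrip) : Bool :=
  !decide (q.2.1.1 = q.2.2.1.1) && decide (q.2.1.2.1 = q.2.2.1.2.1) &&
    inSpan q.1.1 (rowsNe q.1 q.2.2.1.1) (r9 q.2.2.1.2) && !inG q.1 q.2.1.1 q.2.2.1.1 q.2.2.2 &&
    inSpan q.1.1 (rowsNe q.1 q.2.2.1.1) [q.2.2.2.2.2.1, q.2.1.2.2.1]

/-- Solver, class `10`: the indicator of the greedy family of the found `(i, j)`. -/
def sol10 (pr : PRaw) : List Bool :=
  searchOut pr.2.1 ((((enumT pr).product ((enumT pr).product (enumT pr))).find?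
    fun x => test10 (pr, x)).map fun x => gList pr x.1.1 x.2.1.1)

/-- Output length, class `10`. -/
@[simp] theorem length_sol10 (pr : PRaw) : (sol10 pr).length = pr.2.1 := by unfold sol10; simp

/-- The processed rows, as vectors. -/
theorem vecL_image_procRows (J : LocalMap 3 N M) (i j f : Fin M) :
    vecL N '' {x | x ∈ procRows (rawOf J) i.val j.val f.val} = row9 J '' ↑(procSet i j f) := by
  ext v
  simp only [procRows, Set.mem_image, Set.mem_setOf_eq, List.mem_map, List.mem_filter, Bool.and_eq_true,
    Bool.or_eq_true, Bool.not_eq_true', decide_eq_false_iff_not, decide_eq_true_eq, Finset.mem_coe, mem_procSet]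
  constructor
  · rintro ⟨x, ⟨f', ⟨hf', ⟨hj, hf⟩, hor⟩, rfl⟩, rfl⟩
    obtain ⟨p, rfl⟩ := (mem_enumT_iff J).1 hf'
    refine ⟨p, ⟨fun h => hj (congrArg Fin.val h), fun h => hf (congrArg Fin.val h), ?_⟩, (vecL_r9 J p).symm⟩
    rcases hor with h | ⟨h1, h2⟩
    · exact Or.inl (Fin.ext h)
    · exact Or.inr ⟨fun h => h1 (congrArg Fin.val h), h2⟩
  · rintro ⟨p, ⟨hj, hf, hor⟩, rfl⟩
    refine ⟨r9 (tripOf J p), ⟨(p.val, tripOf J p), ⟨mem_enumT J p, ⟨fun h => hj (Fin.ext h), fun h => hf (Fin.ext h)⟩, ?_⟩,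
      rfl⟩, vecL_r9 J p⟩
    rcases hor with h | ⟨h1, h2⟩
    · exact Or.inl (congrArg Fin.val h)
    · exact Or.inr ⟨fun h => h1 (Fin.ext h), h2⟩

/-- Reading `inG`: membership in `gset`. -/
theorem inG_iff (J : LocalMap 3 N M) (i j f : Fin M) :
    inG (rawOf J) i.val j.val (f.val, tripOf J f) = true ↔ f ∈ gset J i j := by
  unfold inG
  rw [mem_gset, Bool.and_eq_true, Bool.not_eq_true', decide_eq_false_iff_not, Bool.not_eq_true',
    Bool.eq_false_iff, ne_eq, inSpan_iff, rawOf_N, vecL_image_procRows, vecL_r9]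
  rw [show (¬ f.val = j.val) ↔ f ≠ j from by rw [ne_eq, Fin.ext_iff]]

/-- Reading `gList`: the greedy family. -/
theorem mem_gList_iff (J : LocalMap 3 N M) (i j f : Fin M) :
    f.val ∈ gList (rawOf J) i.val j.val ↔ f ∈ gset J i j := by
  unfold gList
  rw [List.mem_map]
  constructor
  · rintro ⟨x, hx, hxf⟩
    rw [List.mem_filter] at hx
    obtain ⟨p, rfl⟩ := (mem_enumT_iff J).1 hx.1
    have : p = f := Fin.ext hxf
    subst this
    exact (inG_iff J i j p).1 hx.2
  · intro hf
    exact ⟨(f.val, tripOf J f), List.mem_filter.2 ⟨mem_enumT J f, (inG_iff J i j f).2 hf⟩, rfl⟩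

/-- The tail-rows of the other outputs, as vectors. -/
theorem vecL_image_rowsNe (J : LocalMap 3 N M) (j : Fin M) :
    vecL N '' {x | x ∈ rowsNe (rawOf J) j.val} = row9 J '' {f | f ≠ j} := by
  ext v
  simp only [rowsNe, Set.mem_image, Set.mem_setOf_eq, List.mem_map, List.mem_filter, Bool.not_eq_true',
    decide_eq_false_iff_not]
  constructor
  · rintro ⟨x, ⟨f, ⟨hf, hj⟩, rfl⟩, rfl⟩
    obtain ⟨p, rfl⟩ := (mem_enumT_iff J).1 hf
    exact ⟨p, fun h => hj (congrArg Fin.val h), (vecL_r9 J p).symm⟩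
  · rintro ⟨p, hj, rfl⟩
    exact ⟨r9 (tripOf J p), ⟨(p.val, tripOf J p), ⟨mem_enumT J p, fun h => hj (Fin.ext h)⟩, rfl⟩, vecL_r9 J p⟩

/-- Reading the class-`10` test. -/
theorem test10_iff (J : LocalMap 3 N M) (i j g : Fin M) :
    test10 (rawOf J, (i.val, tripOf J i), (j.val, tripOf J j), (g.val, tripOf J g)) = true ↔
      i ≠ j ∧ J.vars i 0 = J.vars j 0 ∧ row9 J j ∈ Submodule.span (ZMod 2) (row9 J '' {f | f ≠ j}) ∧
        g ∉ gset J i j ∧ ind (J.vars g 1) + ind (J.vars i 1) ∈ Submodule.span (ZMod 2) (row9 J '' {f | f ≠ j}) := by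
  unfold test10
  simp only [Bool.and_eq_true, Bool.not_eq_true', decide_eq_false_iff_not, decide_eq_true_eq, tripOf_fst,
    tripOf_snd_fst]
  rw [inSpan_iff, inSpan_iff, rawOf_N, vecL_image_rowsNe, vecL_r9, vecL_pair, Bool.eq_false_iff, ne_eq, inG_iff,
    show (¬ i.val = j.val) ↔ i ≠ j from by rw [ne_eq, Fin.ext_iff],
    show ((J.vars i 0).val = (J.vars j 0).val) ↔ J.vars i 0 = J.vars j 0 from Fin.ext_iff.symm]
  tauto

/-- Correctness, class `10`. -/
theorem sol10_correct (J : LocalMap 3 N M) (hP : J.IsPure (rep 10)) (hM : 2 * N < M) :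
    (fun p : Fin M => (sol10 (rawOf J)).getD p.val false) ∉ J.range := by
  obtain ⟨i, j, g, hij, hhead, hj, hg, hconn⟩ := cert10_exists hP hM
  set cands := (enumT (rawOf J)).product ((enumT (rawOf J)).product (enumT (rawOf J))) with hc
  have hx₀ := (test10_iff J i j g).2 ⟨hij, hhead, hj, hg, hconn⟩
  have hmem : ((i.val, tripOf J i), (j.val, tripOf J j), (g.val, tripOf J g)) ∈ cands :=
    List.pair_mem_product.2 ⟨mem_enumT J i, List.pair_mem_product.2 ⟨mem_enumT J j, mem_enumT J g⟩⟩
  cases h : cands.find? (fun x => test10 (rawOf J, x)) with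
  | none => exact absurd hx₀ (by have := List.find?_eq_none.1 h _ hmem; simpa using this)
  | some x =>
    obtain ⟨xi, xj, xg⟩ := x
    have hx := List.find?_some h
    have hm := List.mem_of_find?_eq_some h
    obtain ⟨h1, h23⟩ := List.pair_mem_product.1 hm
    obtain ⟨h2, h3⟩ := List.pair_mem_product.1 h23
    obtain ⟨pi, rfl⟩ := (mem_enumT_iff J).1 h1
    obtain ⟨pj, rfl⟩ := (mem_enumT_iff J).1 h2
    obtain ⟨pg, rfl⟩ := (mem_enumT_iff J).1 h3
    obtain ⟨hij', hhead', hj', hg', hconn'⟩ := (test10_iff J pi pj pg).1 hx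
    have hsol : sol10 (rawOf J) = indic M (gList (rawOf J) pi.val pj.val) := by
      unfold sol10; rw [← hc, h]; rfl
    refine cert10_sound hP hij' hhead' hj' hg' hconn' fun f => ?_
    show (sol10 (rawOf J)).getD f.val false = true ↔ _
    rw [hsol, indic_at, decide_eq_true_eq, mem_gList_iff]

/-- `procRows` is polynomial time. -/
theorem codeFP_procRows : CodeFP (pairE prE (pairE natE (pairE natE natE))) (rawE (rawE natE))
    (fun q => procRows q.1 q.2.1 q.2.2.1 q.2.2.2) := by
  have e1 : CodeFP (pairE (pairE prE (pairE natE (pairE natE natE))) etE) natE (fun y => y.2.1) := (snd _ _).fst'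
  have ei : CodeFP (pairE (pairE prE (pairE natE (pairE natE natE))) etE) natE (fun y => y.1.2.1) :=
    (fst _ _).snd'.fst'
  have ej : CodeFP (pairE (pairE prE (pairE natE (pairE natE natE))) etE) natE (fun y => y.1.2.2.1) :=
    (fst _ _).snd'.snd'.fst'
  have ef : CodeFP (pairE (pairE prE (pairE natE (pairE natE natE))) etE) natE (fun y => y.1.2.2.2) :=
    (fst _ _).snd'.snd'.snd'
  have hp : CodeFP (pairE (pairE prE (pairE natE (pairE natE natE))) etE) bitE
      (fun y => !decide (y.2.1 = y.1.2.2.1) && !decide (y.2.1 = y.1.2.2.2) &&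
        (decide (y.2.1 = y.1.2.1) || (!decide (y.1.2.2.2 = y.1.2.1) && decide (y.2.1 < y.1.2.2.2)))) :=
    ((((codeFP_eqTest e1 ej).not.and (codeFP_eqTest e1 ef).not).and
      ((codeFP_eqTest e1 ei).or ((codeFP_eqTest ef ei).not.and
        ((natLt.comp (e1.pair ef)).congr fun _ => rfl)))).congr fun _ => rfl)
  have hf := (filter hp).comp ((CodeFP.id _).pair (codeFP_enumT.comp (fst _ _)))
  exact ((map₀ (codeFP_r9.comp (snd natE tripE))).comp hf).congr fun _ => rfl

/-- `inG` is polynomial time. -/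
theorem codeFP_inG : CodeFP (pairE prE (pairE natE (pairE natE etE))) bitE
    (fun q => inG q.1 q.2.1 q.2.2.1 q.2.2.2) := by
  have hrows : CodeFP (pairE prE (pairE natE (pairE natE etE))) (rawE (rawE natE))
      (fun q => procRows q.1 q.2.1 q.2.2.1 q.2.2.2.1) :=
    codeFP_procRows.comp ((fst _ _).pair ((snd _ _).fst'.pair ((snd _ _).snd'.fst'.pair (snd _ _).snd'.snd'.fst')))
  exact ((codeFP_eqTest (snd _ _).snd'.snd'.fst' (snd _ _).snd'.fst').not.and
    (codeFP_inSpan.comp ((fst _ _).fst'.pair (hrows.pair (codeFP_r9.comp (snd _ _).snd'.snd'.snd')))).not).congr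
    fun _ => rfl

/-- `gList` is polynomial time. -/
theorem codeFP_gList : CodeFP (pairE prE (pairE natE natE)) (rawE natE) (fun q => gList q.1 q.2.1 q.2.2) := by
  have hp : CodeFP (pairE (pairE prE (pairE natE natE)) etE) bitE (fun y => inG y.1.1 y.1.2.1 y.1.2.2 y.2) :=
    codeFP_inG.comp ((fst _ _).fst'.pair ((fst _ _).snd'.fst'.pair ((fst _ _).snd'.snd'.pair (snd _ _))))
  have hf := (filter hp).comp ((CodeFP.id _).pair (codeFP_enumT.comp (fst _ _)))
  exact ((map₀ (fst natE tripE)).comp hf).congr fun _ => rfl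

/-- `rowsNe` is polynomial time. -/
theorem codeFP_rowsNe : CodeFP (pairE prE natE) (rawE (rawE natE)) (fun q => rowsNe q.1 q.2) := by
  have hp : CodeFP (pairE (pairE prE natE) etE) bitE (fun y => !decide (y.2.1 = y.1.2)) :=
    (codeFP_eqTest (snd _ _).fst' (fst _ _).snd').not
  have hf := (filter hp).comp ((CodeFP.id _).pair (codeFP_enumT.comp (fst _ _)))
  exact ((map₀ (codeFP_r9.comp (snd natE tripE))).comp hf).congr fun _ => rfl

/-- Polynomial time, class `10`. -/
theorem codeFP_sol10 : CodeFP prE (rawE bitE) sol10 := by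
  have hc : CodeFP prE (rawE (pairE etE (pairE etE etE)))
      (fun pr => (enumT pr).product ((enumT pr).product (enumT pr))) :=
    (rawProduct _ _).comp (codeFP_enumT.pair ((rawProduct _ _).comp (codeFP_enumT.pair codeFP_enumT)))
  -- projections of `q = (pr, i, j, g)`
  have qpr : CodeFP (pairE prE (pairE etE (pairE etE etE))) prE (fun q => q.1) := fst _ _
  have qi : CodeFP (pairE prE (pairE etE (pairE etE etE))) etE (fun q => q.2.1) := (snd _ _).fst'
  have qj : CodeFP (pairE prE (pairE etE (pairE etE etE))) etE (fun q => q.2.2.1) := (snd _ _).snd'.fst'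
  have qg : CodeFP (pairE prE (pairE etE (pairE etE etE))) etE (fun q => q.2.2.2) := (snd _ _).snd'.snd'
  have hN : CodeFP (pairE prE (pairE etE (pairE etE etE))) unE (fun q => q.1.1) := qpr.fst'
  have hR : CodeFP (pairE prE (pairE etE (pairE etE etE))) (rawE (rawE natE)) (fun q => rowsNe q.1 q.2.2.1.1) :=
    codeFP_rowsNe.comp (qpr.pair qj.fst')
  have ht : CodeFP (pairE prE (pairE etE (pairE etE etE))) bitE test10 :=
    (((((codeFP_eqTest qi.fst' qj.fst').not.and (codeFP_eqTest qi.snd'.fst' qj.snd'.fst')).and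
      (codeFP_inSpan.comp (hN.pair (hR.pair (codeFP_r9.comp qj.snd'))))).and
      (codeFP_inG.comp (qpr.pair (qi.fst'.pair (qj.fst'.pair qg)))).not).and
      (codeFP_inSpan.comp (hN.pair (hR.pair ((rawCons natE).comp (qg.snd'.snd'.fst'.pair
        ((rawSingleton natE).comp qi.snd'.snd'.fst'))))))).congr fun _ => rfl
  have hfind : CodeFP prE (optE (pairE etE (pairE etE etE)))
      (fun pr => ((enumT pr).product ((enumT pr).product (enumT pr))).find? fun x => test10 (pr, x)) :=
    ((rawFind? (σ := PRaw) (eσ := prE) (p := test10) ht).comp ((CodeFP.id prE).pair hc)).congr fun _ => rfl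
  have hro : CodeFP (pairE prE (pairE etE (pairE etE etE))) (rawE natE) (fun q => gList q.1 q.2.1.1 q.2.2.1.1) :=
    codeFP_gList.comp (qpr.pair (qi.fst'.pair qj.fst'))
  have hmap : CodeFP prE (optE (rawE natE)) (fun pr => (((enumT pr).product ((enumT pr).product
      (enumT pr))).find? fun x => test10 (pr, x)).map fun x => gList pr x.1.1 x.2.1.1) :=
    ((optMap (σ := PRaw) (eσ := prE) hro).comp ((CodeFP.id prE).pair hfind)).congr fun _ => rfl
  have hk := optCases (σ := PRaw) (eσ := prE) (eα := rawE natE) (eδ := rawE bitE)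
    (k := fun pr o => searchOut pr.2.1 o)
    (gnone := fun pr => indic pr.2.1 []) (gsome := fun t => indic t.1.2.1 t.2)
    (codeFP_indic.comp (codeFP_M.pair (const prE ([] : List ℕ))))
    (codeFP_indic.comp ((codeFP_M.comp (fst _ _)).pair (snd _ _)))
    (fun _ => rfl) (fun _ _ => rfl)
  exact (hk.comp ((CodeFP.id prE).pair hmap)).congr fun pr => by unfold sol10; rfl

end Summit.PneNP.PneNP.Theorems.Nc03Reduction
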